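import Summits.QuantumFields.YangMills.Theorems.BalabanUVNodesN20KeyedRelWeightAtGappedReading

/-!
# BalabanUVNodes ∕ N20 (NE7b) — THE N20 COLUMN AT dag-n21-d's GAPPED TOP-LETTERED READING, THE INTERIOR PRICED: the gapped reading's canonical persistent-activity fraction is at
# most the sum of per-BIRTH-LEVEL fractions of the GAPPED strata (g3's exact stratification is carrier-free); under print's SURVIVAL SHAPE `V·r^{age}` it is geometric in the AGE
# FLOOR of the cut; the `KeyedRelWeight` body of a gapped pin from per-tuple survival data (companion of `…N20KeyedRelWeightAtGappedReading`)

Cell `pub-ymgap` (HUMAN RULING D-0062 Track A; width push D-0149, director-ym №197), width seat `pub-ymgap-dag-n20-w2` (gen 5) on node N20 = NE7b; key item K3⁸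
`SpineGivenEndpointR13SepCoPHV` = stmt-QuantumFields-27366 (KEY MAP v2; K3⁷ stmt-QuantumFields-20544 aside); `--kind proof --supports … --as helper`; COUNT-NEUTRAL; LOCATED.
[LF-I] = [Balaban1989LargeFieldI], [LF-II] = [Balaban1989LargeFieldII].

WHY.  The companion module reads the N20 face of stub 2 at n21-d's gapped reading `crGap₁₃VAt N K₀ jcut ρ n` in canonical form (`relWeightBound_crGap₁₃VAt_iff`: `(∀ K, W K < 1) ∧
Summable W` on ONE sequence `W ∈ [0, 1]`), free at the zero cut, `= 1` above the window, walled by first-level saturation.  This module prices the INTERIOR of the dial there exactly as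
g3's `…N20KeyedRelWeightLevels` (p606933) did at the reading of record: the persistence class `badClass₁₃ … jcut` is the DISJOINT UNION over birth levels `j < jcut K` of the strata
«first large field exactly at level `j+1`» (`sum_badClass₁₃_eq_sum_strata`, carrier-free), so per-stratum RELATIVE bounds of the GAPPED masses add up to an admissible weight:
* §1 ★★ `W_crGap₁₃VAt_le_sum_levels` (`W K ≤ Σ_{j<jcut K} max (a j K) (b j K)`) · `relWeightBound_crGap₁₃VAt_of_levelFractions` (level sums `< 1`, summable ⇒ the face);
* §2 ★★ `W_crGap₁₃VAt_le_survival` (survival letter `V·r^{K₀+K−(j+1)}` per stratum, cut inside the window ⇒ `W K ≤ V·r^{K₀+K−jcut K}∕(1−r)` — geometric in the AGE FLOOR) ·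
  `relWeightBound_crGap₁₃VAt_of_survival` · `relWeightBound_crGap₁₃VAt_of_survival_linearAge` (summability from `c·K ≤ K₀+K−jcut K`, g3's `summable_ageMajorant_of_linearAge`);
* §2b (live line, rows `hsel` ∕ (H-ζ)) ★★ `W_crGap₁₃VAt_le_survival_of_liveSel` ∕ `relWeightBound_crGap₁₃VAt_of_survival_of_liveSel` — the survival letter against the tuple's OWN
  dressed partition functions `Z_{K₀+K}(t)` ∕ `Z_{K₀+K+1}(t)` (n21-d's E1 ∕ E2 at the gapped reading): print's currency verbatim;
* §2c HONESTY: `levelOne_fraction_le_survival_carriersGap₁₃` · ★ `eventually_cut_eq_zero_of_survival_of_saturated_carriersGap₁₃` — at the CUMULATIVE key the run-A survival letter and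
  eventual first-level saturation (DISPLAYED) meet only along eventually-zero cuts (g3's `…LevelsLive` §5, re-derived at the gapped carriers);
* §3 `keyedRelWeight_shape_crGap₁₃V_of_survival` — the `KeyedRelWeight` body (`N = 2`, per-tuple cut reading `jc`) at `crGap₁₃V (jc …) ρ n` from per-tuple survival data.
WHAT IT SAYS (located, count-neutral): at a gapped pin the N20 conjunct under a cut in the window follows from a per-birth-level SURVIVAL letter at the gapped carriers with a
minimal age `a₀` (`V·r^{a₀} < 1 − r`) and a linear age floor — the same design rule as at the reading of record (g3 §4); the survival letter is NE7b's body in the renewal currency,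
read on the top-lettered terms — NAMED OPEN, NOT PRINTED for `d = 4`, NOT proved; under first-level saturation it is compatible only with an eventually-zero cut (companion §5).
Cited BY NAME, not re-typed: the companion module (`gapWeightA∕B₁₃_nonneg`, `relWeightBound_crGap₁₃VAt_iff`); dag-n21-d `crGap₁₃VAt ∕ crGap₁₃V ∕ gapWeightA∕B₁₃`; dag-n20-d
`classSet₁₃ ∕ badClass₁₃ ∕ wInf`; g3 `…N20KeyedRelWeightLevels` (`sum_badClass₁₃_eq_sum_strata`, `sum_range_pow_age_le`, `summable_ageMajorant_of_linearAge`).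

HONEST FRAMING.  [folklore] finite-sum ∕ real-analysis bookkeeping BY NAME; NO weight bounded, NO estimate proved; every per-level ∕ survival letter is a HYPOTHESIS (NE7b's body at
the gapped carriers — NAMED OPEN); nothing of Bałaban's is asserted; NE7 ∕ NE7b ∕ NE7c NOT PRINTED for `d = 4`, NOT proved; the gapped reading is NOT the registered v6 `PinnedAtLive`
pin (a gapped pin is the PLANNER's call); no `Provisos₁₃CoPH` inhabitant claimed (K0⁷ OPEN); N19 ∕ N20 ∕ N21 ∕ N27 NOT discharged; K3⁸ ∕ K3⁷ NOT closed; counts unmoved (typed 28∕28 ·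
discharged 5∕27); no count claim.  One finite `𝕋⁴_{L^K}` programme at fixed `ε = L^{−K}`, Bałaban AS PRINTED; the YM mass gap (Clay) is NOT proved by any of this — R4 closes the
conditional finite-𝕋⁴ rung `BalabanLadder.UV` only; NOT ℝ⁴, NOT infinite volume, NOT OS.  No `def`, no `instance`, no `notation`, no `sorry`.
Sources (locators, bookkeeping only): [LF-I] p.177 (i)–(ii), p.181; [LF-II] Thm 1 + (0.1) pp.355–356, (1.80) p.384, (1.85)–(1.89) pp.386–387; [King1986] (3.10)–(3.11) p.656.
-/

noncomputable section

open scoped BigOperators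
open Filter Topology

namespace Summit.QuantumFields.YangMills.BalabanUVNodes.N20KeyedRelWeightAtGappedReadingLevels

open Literature.MathematicalPhysics.QuantumFieldTheory.Balaban1983to89 Literature.MathematicalPhysics.QuantumFieldTheory.Balaban1983to89.Node00
open T4Continuum
open T4WeightBudget (RelWeightBound)
open YMDAG.UVSplit (SpineReading₁₃CoPH classSet₁₃ badClass₁₃ badClass₁₃_subset)
open Summit.QuantumFields.YangMills.BalabanUVNodes.SpineCanonicalWeights
open Summit.QuantumFields.YangMills.Theorems.N21ShellSplitOfRecord13CoPH
open Summit.QuantumFields.YangMills.BalabanUVNodes.N20KeyedRelWeightLevels (sum_badClass₁₃_eq_sum_strata sum_range_pow_age_le summable_ageMajorant_of_linearAge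
  badClass₁₃_level_zero)
open Summit.QuantumFields.YangMills.BalabanUVNodes.N20KeyedRelWeightAtGappedReading (gapWeightA₁₃_nonneg gapWeightB₁₃_nonneg relWeightBound_crGap₁₃VAt_iff)

variable {F : T4Family} {N : ℕ} [NeZero N]

/-! ## §1–§2  Per-birth-level fractions; print's survival shape (NE7b's body at the gapped carriers — NAMED OPEN) -/

section Levels

variable (θ : Stage13HParams F N) (hP : θ.Provisos₁₃CoPH F N) (K₀ : ℕ) (g₀ : ℕ → ℝ) (os : List (ULoop F)) (jcut : ℕ → ℕ)
  (ρ : WidthLetter₁₃CoPH N) (n : DepthLetter₁₃CoPH N) [DecidableEq (Σ K, SiteSeqKey F (K₀ + K))]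

/-- **★★ THE GAPPED READING's CANONICAL FRACTION IS AT MOST THE SUM OF THE PER-BIRTH-LEVEL FRACTIONS**: if at step `K`, for every `|t| ≤ 1` and every level `j < jcut K`, the
stratum-`j` GAPPED mass of run A («first large field exactly at level `j+1`», g3's `mem_stratum_iff`) is `≤ a j K ·` run A's gapped class total and run B's is `≤ b j K ·` run B's,
`a j K ≥ 0`, then `W K ≤ Σ_{j<jcut K} max (a j K) (b j K)` — by g3's EXACT, carrier-free stratification `sum_badClass₁₃_eq_sum_strata`.
[cite: Balaban1989LargeFieldII, (1.80) p.384, (1.85)–(1.89) pp.386–387; King1986, (3.10)–(3.11) p.656 (bookkeeping)] -/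
theorem W_crGap₁₃VAt_le_sum_levels {a b : ℕ → ℕ → ℝ} (K : ℕ) (ha : ∀ j < jcut K, 0 ≤ a j K)
    (hA : ∀ t : ℝ, |t| ≤ 1 → ∀ j < jcut K,
      ∑ x ∈ badClass₁₃ θ K₀ g₀ (fun _ => j + 1) K t \ badClass₁₃ θ K₀ g₀ (fun _ => j) K t, gapWeightA₁₃ θ hP K₀ g₀ os (ρ F θ hP g₀ os) (n F θ hP g₀ os) K t x ≤
        a j K * ∑ x ∈ classSet₁₃ θ K₀ g₀ K, gapWeightA₁₃ θ hP K₀ g₀ os (ρ F θ hP g₀ os) (n F θ hP g₀ os) K t x)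
    (hB : ∀ t : ℝ, |t| ≤ 1 → ∀ j < jcut K,
      ∑ x ∈ badClass₁₃ θ K₀ g₀ (fun _ => j + 1) K t \ badClass₁₃ θ K₀ g₀ (fun _ => j) K t, gapWeightB₁₃ θ hP K₀ g₀ os (ρ F θ hP g₀ os) (n F θ hP g₀ os) K t x ≤
        b j K * ∑ x ∈ classSet₁₃ θ K₀ g₀ K, gapWeightB₁₃ θ hP K₀ g₀ os (ρ F θ hP g₀ os) (n F θ hP g₀ os) K t x) :
    (crGap₁₃VAt N K₀ jcut ρ n F θ hP g₀ os).W K ≤ ∑ j ∈ Finset.range (jcut K), max (a j K) (b j K) := by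
  refine wInf_le_of_mem ⟨Finset.sum_nonneg fun j hj => (ha j (Finset.mem_range.1 hj)).trans (le_max_left _ _), fun t ht => ⟨?_, ?_⟩⟩
  · rw [sum_badClass₁₃_eq_sum_strata θ K₀ g₀ jcut K t, Finset.sum_mul]
    exact Finset.sum_le_sum fun j hj => (hA t ht j (Finset.mem_range.1 hj)).trans
      (mul_le_mul_of_nonneg_right (le_max_left _ _) (Finset.sum_nonneg fun x _ => gapWeightA₁₃_nonneg θ hP K₀ g₀ os _ _ K t x))
  · rw [sum_badClass₁₃_eq_sum_strata θ K₀ g₀ jcut K t, Finset.sum_mul]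
    exact Finset.sum_le_sum fun j hj => (hB t ht j (Finset.mem_range.1 hj)).trans
      (mul_le_mul_of_nonneg_right (le_max_right _ _) (Finset.sum_nonneg fun x _ => gapWeightB₁₃_nonneg θ hP K₀ g₀ os _ _ K t x))

/-- **N20 AT THE GAPPED READING FROM PER-BIRTH-LEVEL BUDGETS**: per-stratum relative bounds as above at every step whose level sums are `< 1` and summable over `K` ⇒
`RelWeightBound` AT `crGap₁₃VAt N K₀ jcut ρ n F θ hP g₀ os` with its canonical `W` (§3).  The budgets are NE7b's body at the gapped carriers — NAMED OPEN.
[cite: Balaban1989LargeFieldII, Thm 1 + (0.1) pp.355–356, (1.80) p.384; King1986, (3.10)–(3.11) p.656 (bookkeeping)] -/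
theorem relWeightBound_crGap₁₃VAt_of_levelFractions {a b : ℕ → ℕ → ℝ} (ha : ∀ K, ∀ j < jcut K, 0 ≤ a j K)
    (hA : ∀ (K : ℕ) (t : ℝ), |t| ≤ 1 → ∀ j < jcut K,
      ∑ x ∈ badClass₁₃ θ K₀ g₀ (fun _ => j + 1) K t \ badClass₁₃ θ K₀ g₀ (fun _ => j) K t, gapWeightA₁₃ θ hP K₀ g₀ os (ρ F θ hP g₀ os) (n F θ hP g₀ os) K t x ≤
        a j K * ∑ x ∈ classSet₁₃ θ K₀ g₀ K, gapWeightA₁₃ θ hP K₀ g₀ os (ρ F θ hP g₀ os) (n F θ hP g₀ os) K t x)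
    (hB : ∀ (K : ℕ) (t : ℝ), |t| ≤ 1 → ∀ j < jcut K,
      ∑ x ∈ badClass₁₃ θ K₀ g₀ (fun _ => j + 1) K t \ badClass₁₃ θ K₀ g₀ (fun _ => j) K t, gapWeightB₁₃ θ hP K₀ g₀ os (ρ F θ hP g₀ os) (n F θ hP g₀ os) K t x ≤
        b j K * ∑ x ∈ classSet₁₃ θ K₀ g₀ K, gapWeightB₁₃ θ hP K₀ g₀ os (ρ F θ hP g₀ os) (n F θ hP g₀ os) K t x)
    (hlt : ∀ K, ∑ j ∈ Finset.range (jcut K), max (a j K) (b j K) < 1) (hsum : Summable fun K => ∑ j ∈ Finset.range (jcut K), max (a j K) (b j K)) :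
    RelWeightBound (crGap₁₃VAt N K₀ jcut ρ n F θ hP g₀ os).l₀ (crGap₁₃VAt N K₀ jcut ρ n F θ hP g₀ os).T (crGap₁₃VAt N K₀ jcut ρ n F θ hP g₀ os).A
      (crGap₁₃VAt N K₀ jcut ρ n F θ hP g₀ os).B (crGap₁₃VAt N K₀ jcut ρ n F θ hP g₀ os).Bad (crGap₁₃VAt N K₀ jcut ρ n F θ hP g₀ os).W := by
  have hle : ∀ K, (crGap₁₃VAt N K₀ jcut ρ n F θ hP g₀ os).W K ≤ ∑ j ∈ Finset.range (jcut K), max (a j K) (b j K) := fun K =>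
    W_crGap₁₃VAt_le_sum_levels θ hP K₀ g₀ os jcut ρ n K (ha K) (hA K) (hB K)
  exact (relWeightBound_crGap₁₃VAt_iff θ hP K₀ g₀ os jcut ρ n).2
    ⟨fun K => (hle K).trans_lt (hlt K), Summable.of_nonneg_of_le (fun K => wInf_nonneg K) hle hsum⟩

/-- **★★ THE GAPPED READING's CANONICAL FRACTION UNDER A PER-BIRTH-LEVEL SURVIVAL RATE**: cut inside the window (`jcut K ≤ K₀ + K`) and, for every `|t| ≤ 1` and `j < jcut K`, the
stratum-`j` gapped mass of each run `≤ V·r^{K₀+K−(j+1)} ·` that run's gapped class total (`0 ≤ r < 1`, `0 ≤ V`) ⇒ `W K ≤ V·r^{K₀+K−jcut K}∕(1−r)` — GEOMETRIC IN THE AGE FLOOR.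
[cite: Balaban1989LargeFieldII, (1.80) p.384, (1.89) p.387; Balaban1989LargeFieldI, p.177 (i)–(ii); King1986, (3.10)–(3.11) p.656 (bookkeeping)] -/
theorem W_crGap₁₃VAt_le_survival {r V : ℝ} (h0 : 0 ≤ r) (h1 : r < 1) (hV : 0 ≤ V) (K : ℕ) (hwin : jcut K ≤ K₀ + K)
    (hA : ∀ t : ℝ, |t| ≤ 1 → ∀ j < jcut K,
      ∑ x ∈ badClass₁₃ θ K₀ g₀ (fun _ => j + 1) K t \ badClass₁₃ θ K₀ g₀ (fun _ => j) K t, gapWeightA₁₃ θ hP K₀ g₀ os (ρ F θ hP g₀ os) (n F θ hP g₀ os) K t x ≤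
        V * r ^ (K₀ + K - (j + 1)) * ∑ x ∈ classSet₁₃ θ K₀ g₀ K, gapWeightA₁₃ θ hP K₀ g₀ os (ρ F θ hP g₀ os) (n F θ hP g₀ os) K t x)
    (hB : ∀ t : ℝ, |t| ≤ 1 → ∀ j < jcut K,
      ∑ x ∈ badClass₁₃ θ K₀ g₀ (fun _ => j + 1) K t \ badClass₁₃ θ K₀ g₀ (fun _ => j) K t, gapWeightB₁₃ θ hP K₀ g₀ os (ρ F θ hP g₀ os) (n F θ hP g₀ os) K t x ≤
        V * r ^ (K₀ + K - (j + 1)) * ∑ x ∈ classSet₁₃ θ K₀ g₀ K, gapWeightB₁₃ θ hP K₀ g₀ os (ρ F θ hP g₀ os) (n F θ hP g₀ os) K t x) :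
    (crGap₁₃VAt N K₀ jcut ρ n F θ hP g₀ os).W K ≤ V * r ^ (K₀ + K - jcut K) / (1 - r) := by
  have hnn : ∀ j < jcut K, 0 ≤ V * r ^ (K₀ + K - (j + 1)) := fun j _ => mul_nonneg hV (pow_nonneg h0 _)
  refine (W_crGap₁₃VAt_le_sum_levels θ hP K₀ g₀ os jcut ρ n (a := fun j K => V * r ^ (K₀ + K - (j + 1))) (b := fun j K => V * r ^ (K₀ + K - (j + 1))) K
    hnn hA hB).trans ?_
  simp only [max_self]
  rw [← Finset.mul_sum, mul_div_assoc]
  exact mul_le_mul_of_nonneg_left (sum_range_pow_age_le h0 h1 hwin) hV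

/-- **★★ N20 AT THE GAPPED READING FROM A PER-BIRTH-LEVEL SURVIVAL RATE**: the survival domination at every step (cut inside the window), `V·r^{K₀+K−jcut K}∕(1−r) < 1` at every step
and `Σ_K V·r^{K₀+K−jcut K} < ∞` ⇒ `RelWeightBound` AT `crGap₁₃VAt N K₀ jcut ρ n F θ hP g₀ os` with its canonical `W`.  The survival domination is NE7b's body in the renewal
currency at the gapped carriers — a HYPOTHESIS, NAMED OPEN (NOT PRINTED for `d = 4`, NOT proved).
[cite: Balaban1989LargeFieldII, Thm 1 + (0.1) pp.355–356, (1.80) p.384, (1.89) p.387; King1986, (3.10)–(3.11) p.656 (bookkeeping)] -/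
theorem relWeightBound_crGap₁₃VAt_of_survival {r V : ℝ} (h0 : 0 ≤ r) (h1 : r < 1) (hV : 0 ≤ V) (hwin : ∀ K, jcut K ≤ K₀ + K)
    (hA : ∀ (K : ℕ) (t : ℝ), |t| ≤ 1 → ∀ j < jcut K,
      ∑ x ∈ badClass₁₃ θ K₀ g₀ (fun _ => j + 1) K t \ badClass₁₃ θ K₀ g₀ (fun _ => j) K t, gapWeightA₁₃ θ hP K₀ g₀ os (ρ F θ hP g₀ os) (n F θ hP g₀ os) K t x ≤
        V * r ^ (K₀ + K - (j + 1)) * ∑ x ∈ classSet₁₃ θ K₀ g₀ K, gapWeightA₁₃ θ hP K₀ g₀ os (ρ F θ hP g₀ os) (n F θ hP g₀ os) K t x)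
    (hB : ∀ (K : ℕ) (t : ℝ), |t| ≤ 1 → ∀ j < jcut K,
      ∑ x ∈ badClass₁₃ θ K₀ g₀ (fun _ => j + 1) K t \ badClass₁₃ θ K₀ g₀ (fun _ => j) K t, gapWeightB₁₃ θ hP K₀ g₀ os (ρ F θ hP g₀ os) (n F θ hP g₀ os) K t x ≤
        V * r ^ (K₀ + K - (j + 1)) * ∑ x ∈ classSet₁₃ θ K₀ g₀ K, gapWeightB₁₃ θ hP K₀ g₀ os (ρ F θ hP g₀ os) (n F θ hP g₀ os) K t x)
    (hlt : ∀ K, V * r ^ (K₀ + K - jcut K) / (1 - r) < 1) (hsum : Summable fun K => V * r ^ (K₀ + K - jcut K)) :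
    RelWeightBound (crGap₁₃VAt N K₀ jcut ρ n F θ hP g₀ os).l₀ (crGap₁₃VAt N K₀ jcut ρ n F θ hP g₀ os).T (crGap₁₃VAt N K₀ jcut ρ n F θ hP g₀ os).A
      (crGap₁₃VAt N K₀ jcut ρ n F θ hP g₀ os).B (crGap₁₃VAt N K₀ jcut ρ n F θ hP g₀ os).Bad (crGap₁₃VAt N K₀ jcut ρ n F θ hP g₀ os).W := by
  have hle : ∀ K, (crGap₁₃VAt N K₀ jcut ρ n F θ hP g₀ os).W K ≤ V * r ^ (K₀ + K - jcut K) / (1 - r) := fun K =>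
    W_crGap₁₃VAt_le_survival θ hP K₀ g₀ os jcut ρ n h0 h1 hV K (hwin K) (hA K) (hB K)
  exact (relWeightBound_crGap₁₃VAt_iff θ hP K₀ g₀ os jcut ρ n).2
    ⟨fun K => (hle K).trans_lt (hlt K), Summable.of_nonneg_of_le (fun K => wInf_nonneg K) hle (hsum.div_const (1 - r))⟩

/-- **N20 AT THE GAPPED READING FROM A SURVIVAL RATE AND A LINEAR AGE FLOOR**: as above, with the summability supplied by `c·K ≤ K₀ + K − jcut K` (`c > 0`, `0 < r`) — print's
window policy `jcut K = K₀ + K − j⋆(K)` with `j⋆(K) ≥ c·K` recent levels uncut (g3's `summable_ageMajorant_of_linearAge`).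
[cite: Balaban1989LargeFieldII, Thm 1 + (0.1) pp.355–356, (1.80) p.384, (1.89) p.387; King1986, (3.10)–(3.11) p.656 (bookkeeping)] -/
theorem relWeightBound_crGap₁₃VAt_of_survival_linearAge {r V c : ℝ} (h0 : 0 < r) (h1 : r < 1) (hV : 0 ≤ V) (hc : 0 < c)
    (hwin : ∀ K, jcut K ≤ K₀ + K) (hfrac : ∀ K : ℕ, c * K ≤ ((K₀ + K - jcut K : ℕ) : ℝ))
    (hA : ∀ (K : ℕ) (t : ℝ), |t| ≤ 1 → ∀ j < jcut K,
      ∑ x ∈ badClass₁₃ θ K₀ g₀ (fun _ => j + 1) K t \ badClass₁₃ θ K₀ g₀ (fun _ => j) K t, gapWeightA₁₃ θ hP K₀ g₀ os (ρ F θ hP g₀ os) (n F θ hP g₀ os) K t x ≤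
        V * r ^ (K₀ + K - (j + 1)) * ∑ x ∈ classSet₁₃ θ K₀ g₀ K, gapWeightA₁₃ θ hP K₀ g₀ os (ρ F θ hP g₀ os) (n F θ hP g₀ os) K t x)
    (hB : ∀ (K : ℕ) (t : ℝ), |t| ≤ 1 → ∀ j < jcut K,
      ∑ x ∈ badClass₁₃ θ K₀ g₀ (fun _ => j + 1) K t \ badClass₁₃ θ K₀ g₀ (fun _ => j) K t, gapWeightB₁₃ θ hP K₀ g₀ os (ρ F θ hP g₀ os) (n F θ hP g₀ os) K t x ≤
        V * r ^ (K₀ + K - (j + 1)) * ∑ x ∈ classSet₁₃ θ K₀ g₀ K, gapWeightB₁₃ θ hP K₀ g₀ os (ρ F θ hP g₀ os) (n F θ hP g₀ os) K t x)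
    (hlt : ∀ K, V * r ^ (K₀ + K - jcut K) / (1 - r) < 1) :
    RelWeightBound (crGap₁₃VAt N K₀ jcut ρ n F θ hP g₀ os).l₀ (crGap₁₃VAt N K₀ jcut ρ n F θ hP g₀ os).T (crGap₁₃VAt N K₀ jcut ρ n F θ hP g₀ os).A
      (crGap₁₃VAt N K₀ jcut ρ n F θ hP g₀ os).B (crGap₁₃VAt N K₀ jcut ρ n F θ hP g₀ os).Bad (crGap₁₃VAt N K₀ jcut ρ n F θ hP g₀ os).W :=
  relWeightBound_crGap₁₃VAt_of_survival θ hP K₀ g₀ os jcut ρ n h0.le h1 hV hwin hA hB hlt (summable_ageMajorant_of_linearAge h0 h1 hV hc hfrac)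

end Levels


/-! ## §2b  On the live-selector line: the survival letter against the tuple's own dressed partition functions (print's currency verbatim) -/

section Live

variable (θ : Stage13HParams F N) (hP : θ.Provisos₁₃CoPH F N) (K₀ : ℕ) (g₀ : ℕ → ℝ) (os : List (ULoop F))
  (E : B12.RunParams → ℝ) (hsel : θ.ppSel = ppSelLiveOfRecord F N θ.ν θ.τ9 E (wOfRecord₉ F N θ.toStage9Params)) (hζm : ZetaMeasurable F N θ.ζ)
  (jcut : ℕ → ℕ) (ρ : WidthLetter₁₃CoPH N) (n : DepthLetter₁₃CoPH N) [DecidableEq (Σ K, SiteSeqKey F (K₀ + K))]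
include hsel hζm

/-- **★★ ON THE LIVE LINE, PRINT's CURRENCY VERBATIM AT THE GAPPED READING**: if at step `K` (cut inside the window) the GAPPED (top-lettered) histories of run A whose FIRST large-field
level is `j+1` carry at most `V·r^{K₀+K−(j+1)} · Z_{K₀+K}(t)` of the tuple's own dressed partition function, and those of run B at most `V·r^{K₀+K−(j+1)} · Z_{K₀+K+1}(t)` (`|t| ≤ 1`,
`j < jcut K`; rows `hsel`, (H-ζ) — n21-d's E1 ∕ E2 at the gapped reading), then `W K ≤ V·r^{K₀+K−jcut K}∕(1−r)`.
[cite: Balaban1985UV3, (6) p.257; Balaban1989LargeFieldII, (1.80) p.384, (1.89) p.387; King1986, (3.10)–(3.11) p.656 (bookkeeping)] -/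
theorem W_crGap₁₃VAt_le_survival_of_liveSel {r V : ℝ} (h0 : 0 ≤ r) (h1 : r < 1) (hV : 0 ≤ V) (K : ℕ) (hwin : jcut K ≤ K₀ + K)
    (hA : ∀ t : ℝ, |t| ≤ 1 → ∀ j < jcut K,
      ∑ x ∈ badClass₁₃ θ K₀ g₀ (fun _ => j + 1) K t \ badClass₁₃ θ K₀ g₀ (fun _ => j) K t, gapWeightA₁₃ θ hP K₀ g₀ os (ρ F θ hP g₀ os) (n F θ hP g₀ os) K t x ≤
        V * r ^ (K₀ + K - (j + 1)) * T4GenFunBounds.schemeZ ((datumOfRecord₁₃CoPH F N θ hP).scheme g₀) os (K₀ + K) t)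
    (hB : ∀ t : ℝ, |t| ≤ 1 → ∀ j < jcut K,
      ∑ x ∈ badClass₁₃ θ K₀ g₀ (fun _ => j + 1) K t \ badClass₁₃ θ K₀ g₀ (fun _ => j) K t, gapWeightB₁₃ θ hP K₀ g₀ os (ρ F θ hP g₀ os) (n F θ hP g₀ os) K t x ≤
        V * r ^ (K₀ + K - (j + 1)) * T4GenFunBounds.schemeZ ((datumOfRecord₁₃CoPH F N θ hP).scheme g₀) os (K₀ + K + 1) t) :
    (crGap₁₃VAt N K₀ jcut ρ n F θ hP g₀ os).W K ≤ V * r ^ (K₀ + K - jcut K) / (1 - r) :=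
  W_crGap₁₃VAt_le_survival θ hP K₀ g₀ os jcut ρ n h0 h1 hV K hwin
    (fun t ht j hj => by rw [sum_classSet₁₃_gapWeightA₁₃_eq_schemeZ K₀ θ hP g₀ os E hsel hζm]; exact hA t ht j hj)
    (fun t ht j hj => by rw [sum_classSet₁₃_gapWeightB₁₃_eq_schemeZ K₀ θ hP g₀ os E hsel hζm]; exact hB t ht j hj)

/-- **★★ N20 AT THE GAPPED READING ON THE LIVE LINE FROM PRINT's SURVIVAL SHAPE**: the survival domination against `Z_{K₀+K}(t)` ∕ `Z_{K₀+K+1}(t)` at every step (cut inside the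
window), `V·r^{K₀+K−jcut K}∕(1−r) < 1` at every step and `Σ_K V·r^{K₀+K−jcut K} < ∞` ⇒ `RelWeightBound` AT `crGap₁₃VAt N K₀ jcut ρ n F θ hP g₀ os`.  The domination is NE7b's body —
NAMED OPEN. [cite: Balaban1989LargeFieldII, Thm 1 + (0.1) pp.355–356, (1.80) p.384, (1.89) p.387; King1986, (3.10)–(3.11) p.656 (bookkeeping)] -/
theorem relWeightBound_crGap₁₃VAt_of_survival_of_liveSel {r V : ℝ} (h0 : 0 ≤ r) (h1 : r < 1) (hV : 0 ≤ V) (hwin : ∀ K, jcut K ≤ K₀ + K)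
    (hA : ∀ (K : ℕ) (t : ℝ), |t| ≤ 1 → ∀ j < jcut K,
      ∑ x ∈ badClass₁₃ θ K₀ g₀ (fun _ => j + 1) K t \ badClass₁₃ θ K₀ g₀ (fun _ => j) K t, gapWeightA₁₃ θ hP K₀ g₀ os (ρ F θ hP g₀ os) (n F θ hP g₀ os) K t x ≤
        V * r ^ (K₀ + K - (j + 1)) * T4GenFunBounds.schemeZ ((datumOfRecord₁₃CoPH F N θ hP).scheme g₀) os (K₀ + K) t)
    (hB : ∀ (K : ℕ) (t : ℝ), |t| ≤ 1 → ∀ j < jcut K,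
      ∑ x ∈ badClass₁₃ θ K₀ g₀ (fun _ => j + 1) K t \ badClass₁₃ θ K₀ g₀ (fun _ => j) K t, gapWeightB₁₃ θ hP K₀ g₀ os (ρ F θ hP g₀ os) (n F θ hP g₀ os) K t x ≤
        V * r ^ (K₀ + K - (j + 1)) * T4GenFunBounds.schemeZ ((datumOfRecord₁₃CoPH F N θ hP).scheme g₀) os (K₀ + K + 1) t)
    (hlt : ∀ K, V * r ^ (K₀ + K - jcut K) / (1 - r) < 1) (hsum : Summable fun K => V * r ^ (K₀ + K - jcut K)) :
    RelWeightBound (crGap₁₃VAt N K₀ jcut ρ n F θ hP g₀ os).l₀ (crGap₁₃VAt N K₀ jcut ρ n F θ hP g₀ os).T (crGap₁₃VAt N K₀ jcut ρ n F θ hP g₀ os).A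
      (crGap₁₃VAt N K₀ jcut ρ n F θ hP g₀ os).B (crGap₁₃VAt N K₀ jcut ρ n F θ hP g₀ os).Bad (crGap₁₃VAt N K₀ jcut ρ n F θ hP g₀ os).W := by
  have hle : ∀ K, (crGap₁₃VAt N K₀ jcut ρ n F θ hP g₀ os).W K ≤ V * r ^ (K₀ + K - jcut K) / (1 - r) := fun K =>
    W_crGap₁₃VAt_le_survival_of_liveSel θ hP K₀ g₀ os E hsel hζm jcut ρ n h0 h1 hV K (hwin K) (hA K) (hB K)
  exact (relWeightBound_crGap₁₃VAt_iff θ hP K₀ g₀ os jcut ρ n).2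
    ⟨fun K => (hle K).trans_lt (hlt K), Summable.of_nonneg_of_le (fun K => wInf_nonneg K) hle (hsum.div_const (1 - r))⟩

end Live

/-! ## §2c  HONESTY at the cumulative key: the survival letter and first-level saturation meet only along eventually-zero cuts (g3's `…LevelsLive` §5, at the gapped carriers) -/

section Honesty

variable (θ : Stage13HParams F N) (hP : θ.Provisos₁₃CoPH F N) (K₀ : ℕ) (g₀ : ℕ → ℝ) (os : List (ULoop F)) (ρ : ℕ → ℝ) (n : ℕ → ℕ)
  [DecidableEq (Σ K, SiteSeqKey F (K₀ + K))]

/-- **AT A CUTTING STEP THE SURVIVAL LETTER DOMINATES THE LEVEL-ONE FRACTION** (gapped carriers): the stratum-`0` survival bound (available when `1 ≤ jcut K`) and a level-one fraction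
`κ` at a source with positive run-A gapped mass ⇒ `κ ≤ V·r^{K₀+K−1}`. [cite: Balaban1989LargeFieldII, (1.80) p.384; King1986, (3.10)–(3.11) p.656 (bookkeeping)] -/
theorem levelOne_fraction_le_survival_carriersGap₁₃ {r V κ : ℝ} (K : ℕ) {t : ℝ}
    (hA0 : ∑ x ∈ badClass₁₃ θ K₀ g₀ (fun _ => 0 + 1) K t \ badClass₁₃ θ K₀ g₀ (fun _ => 0) K t, gapWeightA₁₃ θ hP K₀ g₀ os ρ n K t x ≤
      V * r ^ (K₀ + K - (0 + 1)) * ∑ x ∈ classSet₁₃ θ K₀ g₀ K, gapWeightA₁₃ θ hP K₀ g₀ os ρ n K t x)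
    (hpos : 0 < ∑ x ∈ classSet₁₃ θ K₀ g₀ K, gapWeightA₁₃ θ hP K₀ g₀ os ρ n K t x)
    (hκ : κ * ∑ x ∈ classSet₁₃ θ K₀ g₀ K, gapWeightA₁₃ θ hP K₀ g₀ os ρ n K t x ≤ ∑ x ∈ badClass₁₃ θ K₀ g₀ (fun _ => 1) K t, gapWeightA₁₃ θ hP K₀ g₀ os ρ n K t x) :
    κ ≤ V * r ^ (K₀ + K - 1) := by
  rw [badClass₁₃_level_zero θ K₀ g₀ K t, Finset.sdiff_empty] at hA0
  exact le_of_mul_le_mul_right (hκ.trans hA0) hpos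

/-- **★ AT THE CUMULATIVE KEY THE SURVIVAL LETTER AND FIRST-LEVEL SATURATION MEET ONLY ALONG EVENTUALLY-ZERO CUTS** (gapped carriers): the run-A survival domination at every step
(`0 ≤ r < 1`, `V ≥ 0`, cut `jcut`) and EVENTUAL first-level saturation with a fraction `κ > 0` (DISPLAYED) ⇒ `∀ᶠ K, jcut K = 0` — the stratum-`0` factor `V·r^{K₀+K−1} → 0` falls
below `κ`, so no later step can cut a level: §2's hypothesis is inhabitable at a gapped pin only together with an eventually-zero cut (where the face is free).  HONEST: located
bookkeeping; nothing of Bałaban's asserted. [cite: Balaban1989LargeFieldII, (1.80) p.384, (1.89) p.387; King1986, (3.10)–(3.11) p.656 (bookkeeping)] -/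
theorem eventually_cut_eq_zero_of_survival_of_saturated_carriersGap₁₃ {r V κ : ℝ} (h0 : 0 ≤ r) (h1 : r < 1) (hκ0 : 0 < κ) (jcut : ℕ → ℕ)
    (hA : ∀ (K : ℕ) (t : ℝ), |t| ≤ 1 → ∀ j < jcut K,
      ∑ x ∈ badClass₁₃ θ K₀ g₀ (fun _ => j + 1) K t \ badClass₁₃ θ K₀ g₀ (fun _ => j) K t, gapWeightA₁₃ θ hP K₀ g₀ os ρ n K t x ≤
        V * r ^ (K₀ + K - (j + 1)) * ∑ x ∈ classSet₁₃ θ K₀ g₀ K, gapWeightA₁₃ θ hP K₀ g₀ os ρ n K t x)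
    (hsat : ∀ᶠ K in atTop, ∃ t : ℝ, |t| ≤ 1 ∧ 0 < ∑ x ∈ classSet₁₃ θ K₀ g₀ K, gapWeightA₁₃ θ hP K₀ g₀ os ρ n K t x ∧
      κ * ∑ x ∈ classSet₁₃ θ K₀ g₀ K, gapWeightA₁₃ θ hP K₀ g₀ os ρ n K t x ≤ ∑ x ∈ badClass₁₃ θ K₀ g₀ (fun _ => 1) K t, gapWeightA₁₃ θ hP K₀ g₀ os ρ n K t x) :
    ∀ᶠ K in atTop, jcut K = 0 := by
  have hage : Tendsto (fun K : ℕ => K₀ + K - 1) atTop atTop := tendsto_atTop_atTop.2 fun b => ⟨b + 1, fun K hK => by omega⟩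
  have hlim : Tendsto (fun K : ℕ => V * r ^ (K₀ + K - 1)) atTop (𝓝 0) := by
    simpa using ((tendsto_pow_atTop_nhds_zero_of_lt_one h0 h1).comp hage).const_mul V
  filter_upwards [hsat, hlim.eventually (gt_mem_nhds hκ0)] with K hK hlt
  obtain ⟨t, ht, hpos, hle⟩ := hK
  by_contra hne
  have hcut : 0 < jcut K := Nat.pos_of_ne_zero hne
  exact (lt_irrefl κ) ((levelOne_fraction_le_survival_carriersGap₁₃ θ hP K₀ g₀ os ρ n K (hA K t ht 0 hcut) hpos hle).trans_lt hlt)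

end Honesty

/-! ## §3  The K3 binder shape (`N = 2`, per-tuple cut reading `jc`) from per-tuple survival data -/

section Shape

/-- **THE `KeyedRelWeight` BODY AT THE PER-TUPLE-CUT GAPPED READING FROM PER-TUPLE SURVIVAL DATA** (`N = 2`): at every guarded admissible tuple a survival rate `r < 1`, an entropy
letter `V`, the cut inside the window, the per-birth-level survival domination of both runs' GAPPED strata, the age-floor majorant `< 1` and summable ⇒ the N20 conjunct of a gapped
pin.  The survival data are NE7b's body at the gapped carriers — NAMED OPEN.
[cite: Balaban1989LargeFieldII, Thm 1 + (0.1) pp.355–356, (1.80) p.384, (1.89) p.387; King1986, (3.10)–(3.11) p.656 (bookkeeping)] -/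
theorem keyedRelWeight_shape_crGap₁₃V_of_survival
    (jc : (F : T4Family) → (θ : Stage13HParams F 2) → θ.Provisos₁₃CoPH F 2 → (ℕ → ℝ) → List (ULoop F) → ℕ → ℕ) (ρ : WidthLetter₁₃CoPH 2) (n : DepthLetter₁₃CoPH 2)
    (hsurv : ∀ (F : T4Family) (θ : Stage13HParams F 2) (hP : θ.Provisos₁₃CoPH F 2), (θ.ZhUnity F 2 ∧ θ.SlotsNondegenerate₁₃ F 2) → θ.Admissible F 2 →
      ∀ (g₀ : ℕ → ℝ) (os : List (ULoop F)), letI := Classical.decEq (Σ K, SiteSeqKey F (0 + K))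
      ∃ r V : ℝ, 0 ≤ r ∧ r < 1 ∧ 0 ≤ V ∧ (∀ K, jc F θ hP g₀ os K ≤ 0 + K) ∧
        (∀ (K : ℕ) (t : ℝ), |t| ≤ 1 → ∀ j < jc F θ hP g₀ os K,
          ∑ x ∈ badClass₁₃ θ 0 g₀ (fun _ => j + 1) K t \ badClass₁₃ θ 0 g₀ (fun _ => j) K t,
              gapWeightA₁₃ θ hP 0 g₀ os (ρ F θ hP g₀ os) (n F θ hP g₀ os) K t x ≤
            V * r ^ (0 + K - (j + 1)) * ∑ x ∈ classSet₁₃ θ 0 g₀ K, gapWeightA₁₃ θ hP 0 g₀ os (ρ F θ hP g₀ os) (n F θ hP g₀ os) K t x) ∧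
        (∀ (K : ℕ) (t : ℝ), |t| ≤ 1 → ∀ j < jc F θ hP g₀ os K,
          ∑ x ∈ badClass₁₃ θ 0 g₀ (fun _ => j + 1) K t \ badClass₁₃ θ 0 g₀ (fun _ => j) K t,
              gapWeightB₁₃ θ hP 0 g₀ os (ρ F θ hP g₀ os) (n F θ hP g₀ os) K t x ≤
            V * r ^ (0 + K - (j + 1)) * ∑ x ∈ classSet₁₃ θ 0 g₀ K, gapWeightB₁₃ θ hP 0 g₀ os (ρ F θ hP g₀ os) (n F θ hP g₀ os) K t x) ∧
        (∀ K, V * r ^ (0 + K - jc F θ hP g₀ os K) / (1 - r) < 1) ∧ Summable fun K => V * r ^ (0 + K - jc F θ hP g₀ os K)) :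
    ∀ (F : T4Family) (θ : Stage13HParams F 2) (hP : θ.Provisos₁₃CoPH F 2), (θ.ZhUnity F 2 ∧ θ.SlotsNondegenerate₁₃ F 2) → θ.Admissible F 2 →
      ∀ (g₀ : ℕ → ℝ) (os : List (ULoop F)),
        RelWeightBound (crGap₁₃V 2 (jc F θ hP g₀ os) ρ n F θ hP g₀ os).l₀ (crGap₁₃V 2 (jc F θ hP g₀ os) ρ n F θ hP g₀ os).T
          (crGap₁₃V 2 (jc F θ hP g₀ os) ρ n F θ hP g₀ os).A (crGap₁₃V 2 (jc F θ hP g₀ os) ρ n F θ hP g₀ os).B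
          (crGap₁₃V 2 (jc F θ hP g₀ os) ρ n F θ hP g₀ os).Bad (crGap₁₃V 2 (jc F θ hP g₀ os) ρ n F θ hP g₀ os).W := by
  intro F θ hP hG hθ g₀ os
  letI := Classical.decEq (Σ K, SiteSeqKey F (0 + K))
  obtain ⟨r, V, h0, h1, hV, hwin, hA, hB, hlt, hsum⟩ := hsurv F θ hP hG hθ g₀ os
  exact relWeightBound_crGap₁₃VAt_of_survival θ hP 0 g₀ os (jc F θ hP g₀ os) ρ n h0 h1 hV hwin hA hB hlt hsum

end Shape

end Summit.QuantumFields.YangMills.BalabanUVNodes.N20KeyedRelWeightAtGappedReadingLevels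

end
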